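import Mathlib
import Literature.AlgebraicGeometry.Resolution.GRingPowerHyperplaneDescent
import Literature.AlgebraicGeometry.Resolution.FacePreparation
import Literature.AlgebraicGeometry.Resolution.Isolation
import HarnessLib

/-!
# `v`-preparation EXISTS at an isolated point of `{ord J ≥ μ}` of a regular local G-ring of dimension 3

Topic: `Literature/AlgebraicGeometry/Resolution`. The PRODUCER of an initial `v`-prepared label for the
`τ = 1` engine of Cossart–Piltant 2008, Prop. 4.4 / Cossart–Jannsen–Saito, LNM 2270, Ch. 13–14, in the
tree's expansion-free polygon language (`PolygonInvariants`, `FacePreparation.VPrepared`,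
`VertexDissolution`): every consumer in the tree (`BoundedPreparation.exists_preparedUpTo`,
`FacePreparation.exists_wMinusPrepared`, `AdaptedOfPrepared.vPrepared_of_preparedUpTo`, `ReAdaptation`)
ASSUMES `VPrepared c J μ`; CJS obtain it by completing (Thm. 8.24: "If `R` is complete, we can obtain the
stronger conclusion that `(g, z, u)` is well-prepared"), CP work in `R̂`. In a NON-complete ring the naive
loop of constant-lift dissolutions `y ↦ y + λ u₂^b` at the vertex `v` need not stop (char `2`:
`f = y² + u₁u₂³ + u₁⁵ + g²`, `g = u₂²/(1 + u₂)` has the solvable vertices `(0,2), (0,3), (0,4), …`); this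
file proves that for an EXCELLENT (G-ring) `R` and an ISOLATED point of `{ord J ≥ μ}` a `v`-prepared
system nevertheless exists. OURS (a lemma toward the printed proofs; no printed statement has this form).

PROVED (no definitions, no named facts), for `R` regular local of dimension `3`, `c = (y, u₁, u₂)` a
regular system of parameters, `J ⊆ 𝔪^μ`:

* `weightedIdealW_steep_le` — the weighted order ideal of the steep line through `(0, b)` lies in
  `(y, u₂^b)^μ + (u₁)`;
* `exists_dissolve_v_of_not_vPrepared` (B1b) — if `αs < L` and `c` is NOT `v`-prepared then `αs = 0`,
  `βs = L b` (`b ≥ 1`), `J ⊆ (y, u₂^b)^μ + (u₁)`, and after one dissolution `y ↦ y + λ̃ u₂^b` the system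
  still generates `𝔪` and every Newton point lies strictly above the old steep line
  (`VertexDissolution.lt_of_mem_pts_shiftZ_of_isSolvableAt`);
* `exists_vPrepared_of_forall_not_le_span_pair_pow` (B1′) — if `R` is a G-ring, (H)
  `J ⊄ 𝔪^{μ+1} + (u₁)` and NO curve `V(z, u₁)` (`(z, u₁, u₂) = 𝔪`) has `J ⊆ (z, u₁)^μ`, then some `z`
  with `(z, u₁, u₂) = 𝔪` (SAME `u₁, u₂`) has Newton points, `αs < L`, `VPrepared (z, u₁, u₂) J μ`, and
  `z ≡ ε y mod (u₁, u₂) + 𝔪²` for a unit `ε` (`= 1`), indeed `z ≡ ε y mod 𝔪²` when `c` is adapted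
  (`L < δs`) — so `in_𝔪(z) = in_𝔪(y)` and adaptedness / `HasMonic` / `τ` transport unchanged;
* `exists_vPrepared_of_isolated` (B1) — the same under the isolation hypothesis of
  `UniformKrullExponent.exists_uniform_krullExponent_of_isolated` / `NearChainTermination`: no
  non-maximal prime `𝔮` with `J R_𝔮 ⊆ 𝔮^μ R_𝔮` (applied to `𝔮 = (z, u₁)`, a height-two prime).

Proof (two branches). By isolation `αs < L` for EVERY such system, so a non-`v`-prepared system has the
integral vertex `v = (0, b)`, `b ≥ 1`, and B1b applies; iterating (a choice sequence `seq`), the exponents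
`b` strictly increase while the loop runs (`b_n ≥ n + 1`, and `≥ 2` throughout when `L < δs`, since
`δs ≤ αs + βs = L b₀`). EITHER some stage is `v`-prepared (`z − y ∈ (u₂)`), OR the loop never stops and
`J ⊆ ((seq n) + 𝔪^{n+1})^μ + (u₁)` for all `n`; then `GRingPowerHyperplaneDescent` (the G-ring step:
`𝔔 = (ŷ, u₁)R̂ ∩ R` has radical extension, so the formal hyperplane `ŷ` descends) yields `z` with
`(z, u₁, u₂) = 𝔪` and `J ⊆ (z^μ) + (u₁)`, whence every Newton point of `(z, u₁, u₂)` has scaled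
abscissa `≥ 1` (bridge `le_weightedIdealW_levelWeight_iff` with the lines `N x₁ + x₂ = N`) while
`αs < L`: the vertex `v` is not integral and `VPrepared` holds.

Hypothesis (H) is load-bearing (without it: `J = (u₁ y^{μ−1} + u₂^{μ+1})`-type ideals) and refers to
THE GIVEN `u₁`; it holds for ADAPTED coordinates at an order-`μ` point (some `in_μ(g) = Y^μ`), e.g. at a
near point `x′` with `u₁` a local equation of the newest exceptional component; it is NOT automatic for an
older component — the consumer owes it. The G-ring hypothesis is load-bearing (Nagata-type DVR
counterexample in `GRingPowerHyperplaneDescent`). AI-written formalization; weaker than expert review.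
Resolution of singularities in dimension `≥ 4` / characteristic `p` is NOT proved here;
`CossartPiltant2008_prop44` (F-71) is NOT discharged by this file; no summit statement is proved here.

## Sources

* V. Cossart, U. Jannsen, S. Saito, LNM 2270 (2020), Def. 11.2 (`v`-prepared), Thm. 8.16 (dissolution),
  Thm. 8.24 (preparation, complete case), Lemma 11.5, Remark 8.9 (2). [CossartJannsenSaito2020]
* V. Cossart, O. Piltant, J. Algebra 320 (2008) 1051–1082, §4 p. 11 ("`Δ(E; u₁, u₂; y)` is prepared if no
  vertex is solvable … change `y` to `y + λ_v u₁^{v₁} u₂^{v₂}`"), (16). [CossartPiltant2008]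
* H. Matsumura, *Commutative Ring Theory* (1986), §32 p. 256, Thm. 14.2. [Matsumura1987]
-/

noncomputable section

open IsLocalRing MvPolynomial

namespace Literature.AlgebraicGeometry.Resolution

universe u

variable {R : Type u} [CommRing R]

/-! ## The weighted ideal of the steep line through `v = (0, b)` -/

section Steep

variable (c : Fin 3 → R)

/-- For the weight `(L b, L (L b + 1), L)` at level `L b μ` (the steep line through `(0, b)`):
`F ⊆ (y, u₂^b)^μ + (u₁)` — the monomials `y^{e₀} u₂^{e₂}` on or above the line have `e₂ ≥ b (μ − e₀)`.
[cite: CossartJannsenSaito2020, Remark 8.9 (2)] [cite: CossartPiltant2008, §4 p. 11] -/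
theorem weightedIdealW_steep_le (μ b : ℕ) :
    weightedIdealW c (levelWeight μ (μ.factorial * b) (μ.factorial * b + 1) 1)
        (μ.factorial * b * μ) ≤
      Ideal.span {c 0, c 2 ^ b} ^ μ ⊔ Ideal.span {c 1} := by
  rw [weightedIdealW, Ideal.span_le]
  rintro _ ⟨e, he, rfl⟩
  rw [weight_levelWeight] at he
  have hL : 0 < μ.factorial := Nat.factorial_pos μ
  by_cases he1 : e 1 = 0
  · -- on the `u₂`-axis side: `b μ ≤ b e₀ + e₂`
    rw [he1, mul_zero, zero_add] at he
    have he' : b * μ ≤ b * e 0 + e 2 := by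
      have h1 : μ.factorial * b * μ ≤ μ.factorial * b * e 0 + μ.factorial * (1 * e 2) := he
      have h2 : μ.factorial * (b * μ) ≤ μ.factorial * (b * e 0 + e 2) := by
        rw [Nat.mul_add, ← mul_assoc]; rw [one_mul] at h1; rwa [← mul_assoc]
      exact Nat.le_of_mul_le_mul_left h2 hL
    refine Ideal.mem_sup_left ?_
    have hc0 : c 0 ∈ Ideal.span ({c 0, c 2 ^ b} : Set R) := Ideal.subset_span (by simp)
    have hc2 : c 2 ^ b ∈ Ideal.span ({c 0, c 2 ^ b} : Set R) := Ideal.subset_span (by simp)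
    rw [monom3, he1, pow_zero, mul_one]
    by_cases hμe : μ ≤ e 0
    · obtain ⟨k, hk⟩ : ∃ k, e 0 = μ + k := ⟨e 0 - μ, by omega⟩
      rw [hk, pow_add, mul_assoc]
      exact Ideal.mul_mem_right _ _ (Ideal.pow_mem_pow hc0 μ)
    · push Not at hμe
      obtain ⟨m, hm⟩ : ∃ m, μ = e 0 + m := ⟨μ - e 0, by omega⟩
      have he2 : b * m ≤ e 2 := by
        rw [hm, Nat.mul_add] at he'
        omega
      obtain ⟨k, hk⟩ : ∃ k, e 2 = b * m + k := ⟨e 2 - b * m, by omega⟩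
      rw [hk, pow_add, pow_mul, ← mul_assoc]
      refine Ideal.mul_mem_right _ _ ?_
      rw [hm, pow_add]
      exact Ideal.mul_mem_mul (Ideal.pow_mem_pow hc0 _) (Ideal.pow_mem_pow hc2 _)
  · -- a positive power of `u₁`
    refine Ideal.mem_sup_right ?_
    obtain ⟨k, hk⟩ : ∃ k, e 1 = k + 1 := ⟨e 1 - 1, by omega⟩
    rw [monom3, hk, pow_succ]
    have : c 0 ^ e 0 * (c 1 ^ k * c 1) * c 2 ^ e 2 = (c 0 ^ e 0 * c 1 ^ k * c 2 ^ e 2) * c 1 := by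
      ring
    rw [this]
    exact Ideal.mul_mem_left _ _ (Ideal.subset_span rfl)

end Steep

/-! ## One dissolution at the vertex `v` -/

section Step

variable [IsRegularLocalRing R] (c : Fin 3 → R)
  (hgen : Ideal.span {c 0, c 1, c 2} = maximalIdeal R) (hdim : ringKrullDim R = 3)
  {J : Ideal R} {μ : ℕ}

include hgen hdim in
/-- **B1b (OURS). One dissolution AT the vertex `v` under quasi-isolation.** If `J ⊆ 𝔪^μ` has
Newton points, `αs < L` and `c = (y, u₁, u₂)` is NOT `v`-prepared, then `αs = 0`, `βs = L b` with
`1 ≤ b`, the steep line gives `J ⊆ (y, u₂^b)^μ + (u₁)`, and for some `λ̃ ∈ R` the system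
`c′ = (y + λ̃ u₂^b, u₁, u₂)` still generates `𝔪` and has every Newton point strictly above the old
steep line: `L b < (L b + 1)·spt₁ e + spt₂ e` for `e ∈ pts c′ J μ`.
[cite: CossartPiltant2008, §4 p. 11] [cite: CossartJannsenSaito2020, Thm. 8.16, Def. 11.2] -/
theorem exists_dissolve_v_of_not_vPrepared (hJμ : J ≤ maximalIdeal R ^ μ)
    (hne : (pts c J μ).Nonempty) (hα : alphaS c J μ < μ.factorial) (hv : ¬ VPrepared c J μ) :
    ∃ (b : ℕ) (lam : R), 1 ≤ b ∧ alphaS c J μ = 0 ∧ betaS c J μ = μ.factorial * b ∧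
      J ≤ Ideal.span {c 0, c 2 ^ b} ^ μ ⊔ Ideal.span {c 1} ∧
      Ideal.span {shiftZ c (shiftMon c lam 0 b) 0, shiftZ c (shiftMon c lam 0 b) 1,
        shiftZ c (shiftMon c lam 0 b) 2} = maximalIdeal R ∧
      ∀ e ∈ pts (shiftZ c (shiftMon c lam 0 b)) J μ,
        μ.factorial * b < (μ.factorial * b + 1) * spt₁ μ e + 1 * spt₂ μ e := by
  classical
  unfold VPrepared at hv
  push Not at hv
  obtain ⟨v₁, b, lam, hα₁, hβ, hsolv⟩ := hv
  have hL : 0 < μ.factorial := Nat.factorial_pos μ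
  -- `v₁ = 0` by quasi-isolation
  have hv₁ : v₁ = 0 := by
    by_contra h
    have : μ.factorial ≤ μ.factorial * v₁ := Nat.le_mul_of_pos_right _ (Nat.pos_of_ne_zero h)
    omega
  subst hv₁
  rw [mul_zero] at hα₁
  -- `b ≥ 1`
  obtain ⟨ev, hev, hev₁, hev₂⟩ := exists_pts_v hne
  have hb : 1 ≤ b := by
    have := factorial_le_spt_add c hgen hdim hJμ hev
    rw [hev₁, hev₂, hα₁, hβ] at this
    by_contra h
    have hb0 : b = 0 := by omega
    rw [hb0, mul_zero] at this
    omega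
  obtain ⟨lt, rfl⟩ := IsLocalRing.residue_surjective lam
  -- the steep line: level `vLevel = L b`, slope data `steepN = L b + 1`
  have hlev : vLevel c J μ = μ.factorial * b := by rw [vLevel, hα₁, hβ, mul_zero, zero_add]
  have hst : steepN c J μ = μ.factorial * b + 1 := by rw [steepN, hβ]
  have hw₀ : 0 < vLevel c J μ := by rw [hlev]; exact Nat.mul_pos hL hb
  have hp₁ : 0 < steepN c J μ := by rw [steepN]; omega
  refine ⟨b, lt, hb, hα₁, hβ, ?_, ?_, ?_⟩
  · -- `J ⊆ (y, u₂^b)^μ + (u₁)`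
    have hJW : J ≤ weightedIdealW c (vWeight c J μ) (vLevel c J μ * μ) :=
      (le_weightedIdealW_levelWeight_iff c hgen hdim J hw₀ hp₁ Nat.one_pos).mpr forall_pts_vWeight
    rw [vWeight, hlev, hst] at hJW
    exact hJW.trans (weightedIdealW_steep_le c μ b)
  · rw [span_triple_shiftZ c lt (by omega : 0 < 0 + b)]; exact hgen
  · have h := lt_of_mem_pts_shiftZ_of_isSolvableAt c hgen hdim lt (by omega : 0 < 0 + b) hev
      (by rw [hev₁, hα₁, mul_zero]) (by rw [hev₂, hβ]) hw₀ hp₁ Nat.one_pos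
      (by rw [hlev, hst]; ring) forall_pts_vWeight hsolv
    rw [hlev, hst] at h
    exact h

end Step

/-! ## The loop and the assembly -/

section Vec

variable {R : Type u} [CommRing R]

/-- `shiftZ (z, u₁, u₂) t = (z + t, u₁, u₂)` on vector literals (bookkeeping). [folklore] -/
private theorem shiftZ_vec (z u₁ u₂ t : R) : shiftZ ![z, u₁, u₂] t = ![z + t, u₁, u₂] := by
  funext i
  fin_cases i <;> rfl

/-- `shiftMon (z, u₁, u₂) λ 0 b = λ u₂^b` (bookkeeping). [folklore] -/
private theorem shiftMon_vec_zero (z u₁ u₂ lam : R) (b : ℕ) :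
    shiftMon ![z, u₁, u₂] lam 0 b = lam * u₂ ^ b := by
  simp [shiftMon]

end Vec

section Main

variable [IsRegularLocalRing R] (c : Fin 3 → R)
  (hgen : Ideal.span {c 0, c 1, c 2} = maximalIdeal R) (hdim : ringKrullDim R = 3)
  {J : Ideal R} {μ : ℕ}

include hdim in
/-- **The `v`-dissolution step, packaged on vector literals** (private): from `(z, u₁, u₂) = 𝔪`,
coordinate isolation and `¬ VPrepared`, a pair `(b, t)` with `1 ≤ b`, `αs = 0`, `βs = L b`,
`J ⊆ (z, u₂^b)^μ + (u₁)`, `(z + t u₂^b, u₁, u₂) = 𝔪` and all Newton points of the new system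
strictly above the old steep line. [cite: CossartPiltant2008, §4 p. 11] -/
private theorem vDissolve_step_spec (hJμ : J ≤ maximalIdeal R ^ μ)
    (hisol : ∀ z : R, Ideal.span {z, c 1, c 2} = maximalIdeal R → ¬ J ≤ Ideal.span {z, c 1} ^ μ)
    (z : R) (hz : Ideal.span {z, c 1, c 2} = maximalIdeal R)
    (hv : ¬ VPrepared ![z, c 1, c 2] J μ) :
    ∃ p : ℕ × R, 1 ≤ p.1 ∧ alphaS ![z, c 1, c 2] J μ = 0 ∧
      betaS ![z, c 1, c 2] J μ = μ.factorial * p.1 ∧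
      J ≤ Ideal.span {z, c 2 ^ p.1} ^ μ ⊔ Ideal.span {c 1} ∧
      Ideal.span {z + p.2 * c 2 ^ p.1, c 1, c 2} = maximalIdeal R ∧
      ∀ e ∈ pts ![z + p.2 * c 2 ^ p.1, c 1, c 2] J μ,
        μ.factorial * p.1 < (μ.factorial * p.1 + 1) * spt₁ μ e + 1 * spt₂ μ e := by
  have hz' : Ideal.span {(![z, c 1, c 2] : Fin 3 → R) 0, (![z, c 1, c 2] : Fin 3 → R) 1,
      (![z, c 1, c 2] : Fin 3 → R) 2} = maximalIdeal R := hz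
  obtain ⟨hne, hα⟩ := alphaS_lt_of_not_le_span_pair_pow (![z, c 1, c 2]) hz' hdim
    (J := J) (μ := μ) (hisol z hz)
  obtain ⟨b, lam, hb, hα0, hβ, hJle, hgen', hpts⟩ :=
    exists_dissolve_v_of_not_vPrepared (![z, c 1, c 2]) hz' hdim hJμ hne hα hv
  rw [shiftMon_vec_zero, shiftZ_vec] at hgen' hpts
  exact ⟨(b, lam), hb, hα0, hβ, hJle, hgen', hpts⟩

include hgen hdim in
/-- **B1, coordinate form of isolation (OURS).** For `c = (y, u₁, u₂)` a regular system of
parameters of the regular local G-ring `R` of dimension `3`, `J ⊆ 𝔪^μ` with `J ⊄ 𝔪^{μ+1} + (u₁)`,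
and no curve `V(z, u₁)` (`(z, u₁, u₂) = 𝔪`) with `J ⊆ (z, u₁)^μ`: there is `z` with `(z, u₁, u₂) = 𝔪`,
Newton points present, `αs < L`, `(z, u₁, u₂)` `v`-PREPARED, and `z ≡ ε y mod (u₁, u₂) + 𝔪²` for a
unit `ε` — indeed `mod 𝔪²` when `c` is adapted (`L < δs`), so that `in_𝔪(z) = ε̄ · in_𝔪(y)` and
adaptedness, `HasMonic`, `τ` transport to the new system unchanged. (Here `ε = 1` by construction.)
[cite: CossartPiltant2008, §4 p. 11, (16)] [cite: CossartJannsenSaito2020, Def. 11.2, Lemma 11.5, Thm. 8.24]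
[cite: Matsumura1987, §32 p. 256] -/
theorem exists_vPrepared_of_forall_not_le_span_pair_pow (hG : IsGRing R)
    (hJμ : J ≤ maximalIdeal R ^ μ) (hord : ¬ J ≤ maximalIdeal R ^ (μ + 1) ⊔ Ideal.span {c 1})
    (hisol : ∀ z : R, Ideal.span {z, c 1, c 2} = maximalIdeal R → ¬ J ≤ Ideal.span {z, c 1} ^ μ) :
    ∃ z : R, Ideal.span {z, c 1, c 2} = maximalIdeal R ∧
      (pts ![z, c 1, c 2] J μ).Nonempty ∧ alphaS ![z, c 1, c 2] J μ < μ.factorial ∧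
      VPrepared ![z, c 1, c 2] J μ ∧
      ∃ ε : R, IsUnit ε ∧ z - ε * c 0 ∈ Ideal.span {c 1, c 2} ⊔ maximalIdeal R ^ 2 ∧
        (μ.factorial < deltaS c J μ → z - ε * c 0 ∈ maximalIdeal R ^ 2) := by
  classical
  have hL : 0 < μ.factorial := Nat.factorial_pos μ
  -- isolation on vector literals
  have hiso : ∀ z : R, Ideal.span {z, c 1, c 2} = maximalIdeal R →
      (pts ![z, c 1, c 2] J μ).Nonempty ∧ alphaS ![z, c 1, c 2] J μ < μ.factorial := by
    intro z hz
    have hz' : Ideal.span {(![z, c 1, c 2] : Fin 3 → R) 0, (![z, c 1, c 2] : Fin 3 → R) 1,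
        (![z, c 1, c 2] : Fin 3 → R) 2} = maximalIdeal R := hz
    exact alphaS_lt_of_not_le_span_pair_pow (![z, c 1, c 2]) hz' hdim (J := J) (μ := μ)
      (hisol z hz)
  -- the step data, chosen uniformly in `z`
  have hstep' : ∀ z : R, ∃ p : ℕ × R,
      (Ideal.span {z, c 1, c 2} = maximalIdeal R ∧ ¬ VPrepared ![z, c 1, c 2] J μ) →
      (1 ≤ p.1 ∧ alphaS ![z, c 1, c 2] J μ = 0 ∧ betaS ![z, c 1, c 2] J μ = μ.factorial * p.1 ∧
        J ≤ Ideal.span {z, c 2 ^ p.1} ^ μ ⊔ Ideal.span {c 1} ∧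
        Ideal.span {z + p.2 * c 2 ^ p.1, c 1, c 2} = maximalIdeal R ∧
        ∀ e ∈ pts ![z + p.2 * c 2 ^ p.1, c 1, c 2] J μ,
          μ.factorial * p.1 < (μ.factorial * p.1 + 1) * spt₁ μ e + 1 * spt₂ μ e) := by
    intro z
    by_cases h : Ideal.span {z, c 1, c 2} = maximalIdeal R ∧ ¬ VPrepared ![z, c 1, c 2] J μ
    · obtain ⟨p, hp⟩ := vDissolve_step_spec c hdim hJμ hisol z h.1 h.2
      exact ⟨p, fun _ => hp⟩
    · exact ⟨(0, 0), fun h' => absurd h' h⟩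
  choose f hf using hstep'
  obtain ⟨Φ, hΦ1, hΦ2⟩ : ∃ Φ : R → R,
      (∀ z, (Ideal.span {z, c 1, c 2} = maximalIdeal R ∧ ¬ VPrepared ![z, c 1, c 2] J μ) →
        Φ z = z + (f z).2 * c 2 ^ (f z).1) ∧
      (∀ z, ¬ (Ideal.span {z, c 1, c 2} = maximalIdeal R ∧ ¬ VPrepared ![z, c 1, c 2] J μ) →
        Φ z = z) :=
    ⟨fun z => if Ideal.span {z, c 1, c 2} = maximalIdeal R ∧ ¬ VPrepared ![z, c 1, c 2] J μ then
        z + (f z).2 * c 2 ^ (f z).1 else z,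
      fun z h => if_pos h, fun z h => if_neg h⟩
  obtain ⟨seq, hseq0, hseqS⟩ : ∃ seq : ℕ → R, seq 0 = c 0 ∧ ∀ n, seq (n + 1) = Φ (seq n) :=
    ⟨fun n => Φ^[n] (c 0), rfl, fun n => Function.iterate_succ_apply' Φ n (c 0)⟩
  -- invariant: `(seq n, u₁, u₂) = 𝔪`
  have hgenS : ∀ n, Ideal.span {seq n, c 1, c 2} = maximalIdeal R := by
    intro n
    induction n with
    | zero => rw [hseq0]; exact hgen
    | succ n ih =>
      rw [hseqS]
      by_cases h : Ideal.span {seq n, c 1, c 2} = maximalIdeal R ∧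
          ¬ VPrepared ![seq n, c 1, c 2] J μ
      · rw [hΦ1 _ h]; exact (hf _ h).2.2.2.2.1
      · rw [hΦ2 _ h]; exact ih
  -- invariant: while the loop runs, the exponents `b` grow: `b n ≥ n + 1`
  have hbge : ∀ n, ¬ VPrepared ![seq n, c 1, c 2] J μ → n + 1 ≤ (f (seq n)).1 := by
    intro n
    induction n with
    | zero => intro h0; exact (hf _ ⟨hgenS 0, h0⟩).1
    | succ n ih =>
      intro hS
      by_cases h : Ideal.span {seq n, c 1, c 2} = maximalIdeal R ∧
          ¬ VPrepared ![seq n, c 1, c 2] J μ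
      · -- the vertex of stage `n+1` lies strictly above the steep line of stage `n`
        have hn := ih h.2
        obtain ⟨-, -, -, -, -, hpts⟩ := hf _ h
        obtain ⟨-, hα0, hβ1, -, -, -⟩ := hf _ ⟨hgenS (n + 1), hS⟩
        have hne1 := (hiso (seq (n + 1)) (hgenS (n + 1))).1
        obtain ⟨e, he, he1, he2⟩ := exists_pts_v hne1
        have hseq' : seq (n + 1) = seq n + (f (seq n)).2 * c 2 ^ (f (seq n)).1 := by
          rw [hseqS, hΦ1 _ h]
        have hlt := hpts e (by rw [← hseq']; exact he)
        rw [he1, he2, hα0, hβ1, mul_zero, zero_add, one_mul] at hlt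
        have := Nat.lt_of_mul_lt_mul_left hlt
        omega
      · -- the loop had already stopped at stage `n`: contradiction
        exfalso
        have hstop : VPrepared ![seq n, c 1, c 2] J μ := by
          by_contra hv; exact h ⟨hgenS n, hv⟩
        rw [hseqS, hΦ2 _ h] at hS
        exact hS hstop
  -- invariant: `seq (n+1) − seq n ∈ (u₂)`, and `∈ 𝔪²` when `c` is adapted
  have hc2m : c 2 ∈ maximalIdeal R := hgen ▸ Ideal.subset_span (by simp)
  have hstepdiff : ∀ n, seq (n + 1) - seq n ∈ Ideal.span {c 2} ∧
      (μ.factorial < deltaS c J μ → seq (n + 1) - seq n ∈ maximalIdeal R ^ 2) := by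
    intro n
    by_cases h : Ideal.span {seq n, c 1, c 2} = maximalIdeal R ∧
        ¬ VPrepared ![seq n, c 1, c 2] J μ
    · rw [hseqS, hΦ1 _ h, add_sub_cancel_left]
      refine ⟨Ideal.mul_mem_left _ _ (Ideal.pow_mem_of_mem (Ideal.span {c 2})
        (Ideal.subset_span (Set.mem_singleton _)) _ (hf _ h).1), fun hδ => ?_⟩
      -- the exponent is `≥ 2`: for `n ≥ 1` by growth, for `n = 0` by `L < δs ≤ αs + βs = βs`
      have hb2 : 2 ≤ (f (seq n)).1 := by
        rcases Nat.eq_zero_or_pos n with hn0 | hnpos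
        · subst hn0
          obtain ⟨-, hα0, hβ0, -, -, -⟩ := hf _ h
          rw [hseq0, eta_fin_three] at hα0 hβ0
          have hne0 : (pts c J μ).Nonempty := by
            have := (hiso (c 0) (by rw [← hseq0]; exact hgenS 0)).1
            rwa [eta_fin_three] at this
          have hδle := deltaS_le_alphaS_add_betaS hne0
          rw [hα0, hβ0, zero_add] at hδle
          by_contra hlt
          push Not at hlt
          have : (f (seq 0)).1 ≤ 1 := by omega
          have := Nat.mul_le_mul_left μ.factorial this
          rw [hseq0] at this
          omega
        · have := hbge n h.2; omega
      refine Ideal.mul_mem_left _ _ (Ideal.pow_le_pow_right hb2 (Ideal.pow_mem_pow hc2m _))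
    · rw [hseqS, hΦ2 _ h, sub_self]
      exact ⟨Ideal.zero_mem _, fun _ => Ideal.zero_mem _⟩
  have hdiffS : ∀ n, seq n - c 0 ∈ Ideal.span {c 2} ∧
      (μ.factorial < deltaS c J μ → seq n - c 0 ∈ maximalIdeal R ^ 2) := by
    intro n
    induction n with
    | zero => rw [hseq0, sub_self]; exact ⟨Ideal.zero_mem _, fun _ => Ideal.zero_mem _⟩
    | succ n ih =>
      have heq : seq (n + 1) - c 0 = (seq (n + 1) - seq n) + (seq n - c 0) := by ring
      rw [heq]
      exact ⟨Ideal.add_mem _ (hstepdiff n).1 ih.1,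
        fun hδ => Ideal.add_mem _ ((hstepdiff n).2 hδ) (ih.2 hδ)⟩
  -- conclusion from a `v`-prepared `z`
  have hconclude : ∀ z : R, Ideal.span {z, c 1, c 2} = maximalIdeal R →
      VPrepared ![z, c 1, c 2] J μ →
      (z - c 0 ∈ Ideal.span {c 1, c 2} ⊔ maximalIdeal R ^ 2 ∧
        (μ.factorial < deltaS c J μ → z - c 0 ∈ maximalIdeal R ^ 2)) →
      ∃ z : R, Ideal.span {z, c 1, c 2} = maximalIdeal R ∧
        (pts ![z, c 1, c 2] J μ).Nonempty ∧ alphaS ![z, c 1, c 2] J μ < μ.factorial ∧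
        VPrepared ![z, c 1, c 2] J μ ∧
        ∃ ε : R, IsUnit ε ∧ z - ε * c 0 ∈ Ideal.span {c 1, c 2} ⊔ maximalIdeal R ^ 2 ∧
          (μ.factorial < deltaS c J μ → z - ε * c 0 ∈ maximalIdeal R ^ 2) :=
    fun z hz hvp hε => ⟨z, hz, (hiso z hz).1, (hiso z hz).2, hvp, 1, isUnit_one,
      by rw [one_mul]; exact hε.1, by rw [one_mul]; exact hε.2⟩
  by_cases hfin : ∃ n, VPrepared ![seq n, c 1, c 2] J μ
  · -- FINITE case: some stage is `v`-prepared
    obtain ⟨n, hn⟩ := hfin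
    exact hconclude (seq n) (hgenS n) hn
      ⟨Ideal.mem_sup_left (Ideal.span_mono (by simp) (hdiffS n).1), (hdiffS n).2⟩
  · -- INFINITE case: the dissolution never stops
    push Not at hfin
    have hcond : ∀ n, Ideal.span {seq n, c 1, c 2} = maximalIdeal R ∧
        ¬ VPrepared ![seq n, c 1, c 2] J μ := fun n => ⟨hgenS n, hfin n⟩
    obtain ⟨b, hb⟩ : ∃ b : ℕ → ℕ, ∀ n, b n = (f (seq n)).1 := ⟨fun n => (f (seq n)).1, fun n => rfl⟩
    obtain ⟨t, ht⟩ : ∃ t : ℕ → R, ∀ n, t n = (f (seq n)).2 := ⟨fun n => (f (seq n)).2, fun n => rfl⟩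
    have hspec : ∀ n, 1 ≤ b n ∧ alphaS ![seq n, c 1, c 2] J μ = 0 ∧
        betaS ![seq n, c 1, c 2] J μ = μ.factorial * b n ∧
        J ≤ Ideal.span {seq n, c 2 ^ b n} ^ μ ⊔ Ideal.span {c 1} ∧
        Ideal.span {seq n + t n * c 2 ^ b n, c 1, c 2} = maximalIdeal R ∧
        ∀ e ∈ pts ![seq n + t n * c 2 ^ b n, c 1, c 2] J μ,
          μ.factorial * b n < (μ.factorial * b n + 1) * spt₁ μ e + 1 * spt₂ μ e := by
      intro n; rw [hb n, ht n]; exact hf _ (hcond n)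
    have hseqS' : ∀ n, seq (n + 1) = seq n + t n * c 2 ^ b n := fun n => by
      rw [hseqS, hΦ1 _ (hcond n), hb n, ht n]
    have hbge' : ∀ n, n + 1 ≤ b n := fun n => by rw [hb n]; exact hbge n (hfin n)
    -- apply the descent theorem
    have hpow : ∀ n, c 2 ^ b n ∈ maximalIdeal R ^ (n + 1) := fun n =>
      Ideal.pow_le_pow_right (hbge' n) (Ideal.pow_mem_pow hc2m (b n))
    obtain ⟨z, hz, hJz, hzy, hzy2⟩ := exists_span_pow_sup_of_adicLimit' hG hdim (c 1) (c 2) seq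
      (by rw [hseq0]; exact hgen)
      (fun n => by
        rw [hseqS', add_sub_cancel_left]
        refine Ideal.mul_mem_left _ _ (Ideal.pow_mem_of_mem _ ?_ _ (hspec n).1)
        exact Ideal.subset_span (by simp))
      (fun n => by
        rw [hseqS', add_sub_cancel_left]
        exact Ideal.mul_mem_left _ _ (hpow n))
      (J := J) (μ := μ)
      (fun n => by
        refine (hspec n).2.2.2.1.trans (sup_le_sup_right (Ideal.pow_right_mono ?_ μ) _)
        rw [Ideal.span_le]
        intro s hs
        simp only [Set.mem_insert_iff, Set.mem_singleton_iff] at hs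
        rcases hs with rfl | rfl
        · exact Ideal.mem_sup_left (Ideal.subset_span rfl)
        · exact Ideal.mem_sup_right (hpow n))
      hord
    rw [hseq0] at hzy hzy2
    refine hconclude z hz ?_ ⟨hzy, fun hδ => hzy2 fun n => (hstepdiff n).2 hδ⟩
    -- `1 ≤ αs < L`: the vertex `v` is not integral, so `(z, u₁, u₂)` is `v`-prepared
    obtain ⟨hne, hαlt⟩ := hiso z hz
    have hz' : Ideal.span {(![z, c 1, c 2] : Fin 3 → R) 0, (![z, c 1, c 2] : Fin 3 → R) 1,
        (![z, c 1, c 2] : Fin 3 → R) 2} = maximalIdeal R := hz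
    have hαpos : 0 < alphaS ![z, c 1, c 2] J μ := by
      obtain ⟨e, he, he1⟩ := exists_pts_alphaS hne
      by_contra h0
      push Not at h0
      have h0' : alphaS ![z, c 1, c 2] J μ = 0 := Nat.le_zero.mp h0
      set N := spt₂ μ e + 1 with hN
      have hNpos : 0 < N := Nat.succ_pos _
      have hJW : J ≤ weightedIdealW ![z, c 1, c 2] (levelWeight μ N N 1) (N * μ) := by
        refine hJz.trans (sup_le ?_ ?_)
        · rw [Ideal.span_singleton_le_iff_mem]
          have hmem := monomial_mem_weightedIdealW (![z, c 1, c 2]) (levelWeight μ N N 1)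
            (ρ := N * μ) (e := Finsupp.single 0 μ) (by rw [weight_levelWeight]; simp)
          have hmon : monom3 ![z, c 1, c 2] (Finsupp.single 0 μ) = z ^ μ := by simp [monom3]
          rw [hmon] at hmem
          exact hmem
        · rw [Ideal.span_singleton_le_iff_mem]
          have hw : N * μ ≤ Finsupp.weight (levelWeight μ N N 1) (Finsupp.single (1 : Fin 3) 1) := by
            rw [weight_levelWeight]
            simp only [Finsupp.single_eq_same, ne_eq, Fin.reduceEq, not_false_eq_true,
              Finsupp.single_eq_of_ne, mul_zero, zero_add, mul_one, add_zero]
            calc N * μ ≤ N * μ.factorial := Nat.mul_le_mul_left _ (Nat.self_le_factorial μ)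
              _ = μ.factorial * N := mul_comm _ _
          have hmem := monomial_mem_weightedIdealW (![z, c 1, c 2]) (levelWeight μ N N 1) hw
          have hmon : monom3 ![z, c 1, c 2] (Finsupp.single 1 1) = c 1 := by simp [monom3]
          rw [hmon] at hmem
          exact hmem
      have hall := (le_weightedIdealW_levelWeight_iff (![z, c 1, c 2]) hz' hdim J hNpos hNpos
        Nat.one_pos).mp hJW e he
      rw [he1, h0', mul_zero, zero_add, one_mul] at hall
      omega
    intro v₁ v₂ lam hα₁ hβ₁ hsol
    rcases Nat.eq_zero_or_pos v₁ with h0 | hpos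
    · rw [h0, mul_zero] at hα₁; omega
    · have : μ.factorial ≤ μ.factorial * v₁ := Nat.le_mul_of_pos_right _ hpos
      omega

include hgen hdim in
/-- **B1 (OURS). `v`-PREPARATION EXISTS at an isolated point of `{ord J ≥ μ}` of a regular local
G-ring of dimension `3`.** For `c = (y, u₁, u₂)` a regular system of parameters, `J ⊆ 𝔪^μ` with
`J ⊄ 𝔪^{μ+1} + (u₁)` and no non-maximal prime `𝔮` with `J R_𝔮 ⊆ 𝔮^μ R_𝔮` (the closed point is
isolated in `{ord J ≥ μ}`), there is `z ∈ R` such that `(z, u₁, u₂)` is a regular system of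
parameters (same `u₁, u₂`), the polygon `Δ(J; u₁, u₂; z)` is non-empty with `αs < L`, `(z, u₁, u₂)` is
`v`-PREPARED (`VPrepared`), and `z ≡ ε y mod (u₁, u₂) + 𝔪²` for a unit `ε`, indeed `mod 𝔪²` when
`c` is adapted (`L < δs`). [cite: CossartJannsenSaito2020, Def. 11.2, Thm. 8.16, Thm. 8.24]
[cite: CossartPiltant2008, §4 p. 11] [cite: Matsumura1987, §32 p. 256] -/
theorem exists_vPrepared_of_isolated (hG : IsGRing R) (hJμ : J ≤ maximalIdeal R ^ μ)
    (hord : ¬ J ≤ maximalIdeal R ^ (μ + 1) ⊔ Ideal.span {c 1})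
    (hisol : ∀ (𝔮 : Ideal R) [𝔮.IsPrime], 𝔮 ≠ maximalIdeal R →
      ¬ J.map (algebraMap R (Localization.AtPrime 𝔮)) ≤ maximalIdeal (Localization.AtPrime 𝔮) ^ μ) :
    ∃ z : R, Ideal.span {z, c 1, c 2} = maximalIdeal R ∧
      (pts ![z, c 1, c 2] J μ).Nonempty ∧ alphaS ![z, c 1, c 2] J μ < μ.factorial ∧
      VPrepared ![z, c 1, c 2] J μ ∧
      ∃ ε : R, IsUnit ε ∧ z - ε * c 0 ∈ Ideal.span {c 1, c 2} ⊔ maximalIdeal R ^ 2 ∧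
        (μ.factorial < deltaS c J μ → z - ε * c 0 ∈ maximalIdeal R ^ 2) := by
  refine exists_vPrepared_of_forall_not_le_span_pair_pow c hgen hdim hG hJμ hord fun z hz hle => ?_
  -- `(z, u₁)` is a prime different from `𝔪`
  have hfr : (maximalIdeal R).spanFinrank = 3 := by
    have h := IsRegularLocalRing.spanFinrank_maximalIdeal (R := R)
    rw [hdim] at h
    exact_mod_cast h
  set x : Fin 3 → R := ![z, c 1, c 2] with hx
  have hx0 : x 0 = z := rfl
  have hx1 : x 1 = c 1 := rfl
  have hx2 : x 2 = c 2 := rfl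
  have hxrange : Set.range x = {z, c 1, c 2} := by
    ext s
    simp only [Set.mem_range, Set.mem_insert_iff, Set.mem_singleton_iff]
    constructor
    · rintro ⟨i, rfl⟩
      fin_cases i
      · exact Or.inl hx0
      · exact Or.inr (Or.inl hx1)
      · exact Or.inr (Or.inr hx2)
    · rintro (rfl | rfl | rfl)
      exacts [⟨0, hx0⟩, ⟨1, hx1⟩, ⟨2, hx2⟩]
  have hxr : Ideal.span (Set.range x) = maximalIdeal R := by rw [hxrange, hz]
  set 𝔮 : Ideal R := Ideal.span {z, c 1} with h𝔮
  have h𝔮prime : 𝔮.IsPrime := by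
    have h := isPrime_span_image hfr x hxr ({0, 1} : Finset (Fin 3))
    rwa [Finset.coe_pair, Set.image_pair, hx0, hx1] at h
  have h𝔮ne : 𝔮 ≠ maximalIdeal R := by
    intro heq
    have h := not_mem_span_image_of_not_mem hfr x hxr (S := {0, 1}) (i := 2) (by simp)
    rw [Set.image_pair, hx0, hx1] at h
    apply h
    change c 2 ∈ 𝔮
    rw [heq, ← hz]
    exact Ideal.subset_span (by simp)
  haveI := h𝔮prime
  refine hisol 𝔮 h𝔮ne ?_
  rw [← Localization.AtPrime.map_eq_maximalIdeal, ← Ideal.map_pow]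
  exact Ideal.map_mono hle

end Main

end Literature.AlgebraicGeometry.Resolution

end
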